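import Literature.AnabelianGeometry.AbsoluteAnabelian.FundamentalExtension
import HarnessLib

/-!
# Sections of the augmentation `Π ↠ G` (rational points)

Companion to `FundamentalExtension.lean` (the abc-iut L4 interface): the datum of a *section*
`s_x : G_k → Π_X` of the augmentation, attached in print to a rational point `x ∈ X(k)`
([AbsTopIII] Prop. 1.6 (ii) p. 35: "For `x ∈ X(k)`, write `s_x : G_k → Π_X` for the associated
section [well-defined up to conjugation by `Δ_X`]"; manuscript pages of lit key
`paper:url-5493eb38cbb7`).  Added on the referee audit of the interface (ref-b PASS-8, gap B8:
`CuspidalData.IsRational` only records the surjectivity shadow for cusps).  Pure group theory;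
nothing asserts that a given section arises from a point.
-/

namespace Literature.AnabelianGeometry.AbsoluteAnabelian

universe u

namespace FundamentalExtension

/-- A *section* of the augmentation `Π ↠ G`: "For `x ∈ X(k)`, write `s_x : G_k → Π_X` for the
associated section [well-defined up to conjugation by `Δ_X`]" ([AbsTopIII] Prop. 1.6 (ii) p. 35;
the sections `s_{x_i} : G_{k_x} → Π_U` of Prop. 1.8 (i) p. 36 over finite extensions are sections
over an open subgroup of `G` and are not typed here). [cite: MochizukiAbsTopIII2015, Prop 1.6 (ii) p.35] -/
structure Section (E : FundamentalExtension.{u}) : Type u where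
  /-- the continuous homomorphism `s : G → Π` -/
  toHom : E.gal →ₜ* E.arith
  /-- `aug ∘ s = id` -/
  aug_toHom : ∀ g, E.aug (toHom g) = g

namespace Section

variable {E : FundamentalExtension.{u}} (s : E.Section)

/-- A section is injective. [cite: MochizukiAbsTopIII2015, Prop 1.6 (ii) p.35] -/
theorem injective : Function.Injective s.toHom := by
  intro g h hgh
  rw [← s.aug_toHom g, ← s.aug_toHom h, hgh]

/-- The *decomposition group* `D_x := s_x(G_k) ⊆ Π_X` of the section (its image).
[cite: MochizukiAbsTopIII2015, Prop 1.6 (ii) p.35] -/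
def decompositionGroup : Subgroup E.arith := s.toHom.toMonoidHom.range

/-- The decomposition group of a section meets `Δ` trivially.
[cite: MochizukiAbsTopIII2015, Prop 1.6 (ii) p.35] -/
theorem decompositionGroup_inf_geom : s.decompositionGroup ⊓ E.geom = ⊥ := by
  rw [eq_bot_iff]
  rintro y ⟨⟨g, rfl⟩, hy⟩
  have hg : g = 1 := by
    have h1 := s.aug_toHom g
    have h2 : E.aug (s.toHom g) = 1 := (E.mem_geom).mp hy
    rw [h2] at h1
    exact h1.symm
  subst hg
  simp

/-- The conjugate of a section by an element of `Δ` ("well-defined up to conjugation by `Δ_X`").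
[cite: MochizukiAbsTopIII2015, Prop 1.6 (ii) p.35] -/
noncomputable def conj (d : E.geom) : E.Section where
  toHom := ContinuousMonoidHom.comp
    { toMonoidHom := (MulAut.conj (d : E.arith)).toMonoidHom
      continuous_toFun := by
        change Continuous fun x : E.arith => (d : E.arith) * x * (d : E.arith)⁻¹
        fun_prop }
    s.toHom
  aug_toHom g := by
    change E.aug ((d : E.arith) * s.toHom g * (d : E.arith)⁻¹) = g
    rw [map_mul, map_mul, map_inv, (E.mem_geom).mp d.2, s.aug_toHom, one_mul, inv_one, mul_one]

end Section

end FundamentalExtension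

end Literature.AnabelianGeometry.AbsoluteAnabelian
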